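import Literature.NumberTheory.EllipticCurves.SqrtTwoTwistEightTorsion
import Literature.NumberTheory.EllipticCurves.SqrtTwoTwistBrewerThreeModEight
import Literature.NumberTheory.EllipticCurves.SqrtTwoTwistJInvariant
import Literature.NumberTheory.EllipticCurves.SqrtTwoTwistBrewerOneModEight
import Literature.NumberTheory.EllipticCurves.FrobeniusManinProofs
import Literature.NumberTheory.EllipticCurves.FrobeniusTateModule
import Literature.NumberTheory.EllipticCurves.IsogenyDualProofs
import HarnessLib

/-!
# Brewer's character sum is a theorem; `L(E, s)` is entire for every elliptic `E/ℚ` with `j = 8000` — unconditionally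

Topic `Literature/NumberTheory/EllipticCurves`, namespace `Literature.NumberTheory.EllipticCurves.SqrtTwoTwist`
(capstone of the `SqrtTwoTwist*` series).  THEOREMS ONLY.

§1 proves the `p ≡ 3 (mod 8)` half of the sign law for `B₁ : y² = x³ + 4x² + 2x` (Cremona `256d1`, CM by `ℤ[√-2]`):
with `a_p(B₁) = 2a` one has `a ≡ 3 (mod 4)` for `p ≡ 3 (mod 16)` and `a ≡ 1 (mod 4)` for `p ≡ 11 (mod 16)`
(`frobeniusTrace_half_mod_four_of_three`).  The proof is the `8`-torsion Frobenius argument of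
`SqrtTwoTwistEightTorsion`: over `\bar 𝔽_p` take `w² = 2`, `t² = 2 + w`, `R = (w, 2t)` (order `4`, `2R = T₀ = (0,0)`),
`T± = (-2 ± w, 0)`, the `𝔽_p`-rational endomorphism `ψ = [√-2]` (`DeuringSqrtTwo.sqrtNegTwo`, `ψ² = [-2]`,
`ψR = T₋`, `ψT± = T₀`), a point `S` with `2S = R` (`ψ` is surjective on `\bar 𝔽_p`-points), and the `p`-Frobenius `σ`:
`σR = (-w, 2t·(2+w)^{(p-1)/2}) = εR + T₋` with `ε = -1, +1` for `p ≡ 3, 11 (mod 16)` (the octic evaluation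
`two_add_w_pow`), and the tree's ELEMENTARY pointwise relation `σ²S - a_p σS + pS = 0`
(`WeierstrassCurve.frobenius_sq_sub_trace_smul_add_card_smul`, Manin's method) forces `a_p ≡ 2ε (mod 8)`
(`EightTorsion.trace_mod_eight`).  No cyclotomy, no Jacobi or Eisenstein sums, no class field theory.

§2 assembles: Brewer's theorem for `p ≡ 3 (mod 8)` (`brewer_characterSum_of_mod_eight_eq_three`, with the unsigned
Deuring `exists_sq_add_two_sq_and_frobeniusTrace_eq` and uniqueness of `p = a² + 2b²`), hence the named facts
`Brewer1961_characterSum_three` and `Brewer1961_characterSum` are DISCHARGED (`…_holds`), and the `ℤ[√-2]` theta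
dictionary becomes unconditional: `L(B_n, s)` is entire for every square-free `n` (`hasEntireLFunction_B`) and
**`L(E, s)` has an entire continuation for every elliptic curve `E/ℚ` with `j(E) = 8000`**
(`hasEntireLFunction_of_j_eq_8000_holds`) — the `j = 8000` row of the Deuring–Hecke leaf
`hasEntireLFunction_of_j_mem_maximalCMJInvariants`, now a theorem of the tree.

References: Brewer, *On certain character sums*, TAMS 99 (1961), Thm. 2; Leonard–Williams, Rocky Mountain J. Math. 5
(1975), Theorem p. 301; Rajwade, Proc. Camb. Phil. Soc. 64 (1968), Thm. 1; Silverman *AEC* V.2.3.1.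
-/

noncomputable section

open scoped Classical

namespace Literature.NumberTheory.EllipticCurves

namespace SqrtTwoTwist

open _root_.WeierstrassCurve

/-! ### §1 The trace of Frobenius of `B₁` modulo `8` for `p ≡ 3 (mod 8)` -/

section TraceModEight

variable {p : ℕ} [Fact p.Prime]

/-- **`a_p(B₁) mod 8` for `p ≡ 3 (mod 8)`** on the model `DeuringSqrtTwo.curve p = (0, 4, 0, 2, 0) / 𝔽_p`:
`p + 1 - #B₁(𝔽_p) ≡ 2 (mod 8)` if `p ≡ 11 (mod 16)` and `≡ 6 (mod 8)` if `p ≡ 3 (mod 16)`.  The `8`-torsion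
Frobenius argument (module docstring). [cite: Rajwade1968, Thm. 1] [cite: LeonardWilliams1975, Theorem (p. 301)] -/
theorem tr_curve_mod_eight (hp8 : p % 8 = 3) :
    HasseManin.tr (DeuringSqrtTwo.curve p) % 8 = if p % 16 = 11 then 2 else 6 := by
  have hp : p.Prime := Fact.out
  have hp2 : p ≠ 2 := by rintro rfl; norm_num at hp8
  have hpodd : Odd p := hp.odd_of_ne_two hp2
  haveI hEll : (DeuringSqrtTwo.curve p).IsElliptic := DeuringSqrtTwo.isElliptic_curve hp2
  -- the arithmetic Frobenius
  obtain ⟨σ, hσ⟩ := WeierstrassCurve.exists_frobenius_absoluteGaloisGroup (ZMod p)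
  have hσ' : ∀ x : AlgebraicClosure (ZMod p), σ • x = x ^ p := fun x ↦ by rw [hσ, Nat.card_zmod]
  set f : AlgebraicClosure (ZMod p) →ₐ[ZMod p] AlgebraicClosure (ZMod p) :=
    ((show AlgebraicClosure (ZMod p) ≃ₐ[ZMod p] AlgebraicClosure (ZMod p) from σ) :
      AlgebraicClosure (ZMod p) →ₐ[ZMod p] AlgebraicClosure (ZMod p)) with hf
  have hfx : ∀ x, f x = x ^ p := fun x ↦ hσ' x
  have hsmul : ∀ P : (DeuringSqrtTwo.curve p).geomPoints, σ • P = Affine.Point.map f P := fun P ↦ rfl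
  -- `√-2 ∈ 𝔽_p` and `ψ = [√-2]`
  obtain ⟨sK, hsK⟩ : ∃ s : ZMod p, s ^ 2 = -2 := by
    obtain ⟨r, hr⟩ := (ZMod.exists_sq_eq_neg_two_iff hp2).mpr (Or.inr hp8)
    exact ⟨r, by rw [sq, ← hr]⟩
  set ψ := DeuringSqrtTwo.sqrtNegTwo hp2 sK hsK with hψdef
  -- elements of `\bar 𝔽_p`
  have h2 : (2 : AlgebraicClosure (ZMod p)) ≠ 0 := DeuringSqrtTwo.two_ne_zero_bar hp2
  obtain ⟨w, hw⟩ := IsAlgClosed.exists_pow_nat_eq (2 : AlgebraicClosure (ZMod p)) two_pos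
  obtain ⟨t, ht⟩ := IsAlgClosed.exists_pow_nat_eq (2 + w : AlgebraicClosure (ZMod p)) two_pos
  obtain ⟨δ, hδ⟩ := IsAlgClosed.exists_pow_nat_eq (-2 : AlgebraicClosure (ZMod p)) two_pos
  obtain ⟨h₁, h₂, h₃, h₄, h₆⟩ := EightTorsion.a_baseChange (p := p)
  have hns : ∀ x y : AlgebraicClosure (ZMod p), y ^ 2 = x ^ 3 + 4 * x ^ 2 + 2 * x →
      ((DeuringSqrtTwo.curve p).baseChange (AlgebraicClosure (ZMod p))).toAffine.Nonsingular x y :=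
    fun x y h ↦ EightTorsion.nonsingular_of_eq h₁ h₂ h₃ h₄ h₆ h2 h
  have eR : (2 * t) ^ 2 = w ^ 3 + 4 * w ^ 2 + 2 * w := by rw [mul_pow, ht]; linear_combination -(w + 4) * hw
  have eR' : (2 * -t) ^ 2 = w ^ 3 + 4 * w ^ 2 + 2 * w := by rw [← eR]; ring
  have eT0 : (0 : AlgebraicClosure (ZMod p)) ^ 2 = 0 ^ 3 + 4 * 0 ^ 2 + 2 * 0 := by ring
  have eTp : (0 : AlgebraicClosure (ZMod p)) ^ 2 = (-2 + w) ^ 3 + 4 * (-2 + w) ^ 2 + 2 * (-2 + w) := by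
    linear_combination (2 - w) * hw
  have eTm : (0 : AlgebraicClosure (ZMod p)) ^ 2 = (-2 - w) ^ 3 + 4 * (-2 - w) ^ 2 + 2 * (-2 - w) := by
    linear_combination (2 + w) * hw
  have eRm : (2 * t * (1 - w)) ^ 2 = (-w) ^ 3 + 4 * (-w) ^ 2 + 2 * (-w) := by
    linear_combination 4 * (1 - w) ^ 2 * ht + (5 * w - 4) * hw
  have eRm' : (2 * -t * (1 - w)) ^ 2 = (-w) ^ 3 + 4 * (-w) ^ 2 + 2 * (-w) := by rw [← eRm]; ring
  set R : (DeuringSqrtTwo.curve p).geomPoints := Affine.Point.some w (2 * t) (hns _ _ eR) with hRdef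
  set T₀ : (DeuringSqrtTwo.curve p).geomPoints := Affine.Point.some 0 0 (hns _ _ eT0) with hT₀def
  set Tp : (DeuringSqrtTwo.curve p).geomPoints := Affine.Point.some (-2 + w) 0 (hns _ _ eTp) with hTpdef
  set Tm : (DeuringSqrtTwo.curve p).geomPoints := Affine.Point.some (-2 - w) 0 (hns _ _ eTm) with hTmdef
  -- a point `S = -S₂` with `2S = R` (`ψ` is surjective and `ψ² = [-2]`)
  obtain ⟨S₁, hS₁⟩ := ψ.surjective R
  obtain ⟨S₂, hS₂⟩ := ψ.surjective S₁
  have h2S : (2 : ℤ) • (-S₂) = R := by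
    rw [zsmul_neg, ← neg_zsmul, ← DeuringSqrtTwo.sqrtNegTwo_comp_self hp2 sK hsK S₂]
    change ψ (ψ S₂) = R
    rw [hS₂, hS₁]
  -- group law
  have h2R : (2 : ℤ) • R = T₀ := by
    rw [two_zsmul]; exact EightTorsion.R_add_R h₁ h₂ h₃ h₄ h2 hw ht _ _
  have h2T₀ : (2 : ℤ) • T₀ = 0 := by rw [two_zsmul]; exact EightTorsion.T_add_T h₁ h₃ _
  have h2Tm : (2 : ℤ) • Tm = 0 := by rw [two_zsmul]; exact EightTorsion.T_add_T h₁ h₃ _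
  have hT₀0 : T₀ ≠ 0 := Affine.Point.some_ne_zero _
  have hTm0 : Tm ≠ 0 := Affine.Point.some_ne_zero _
  have hTpm : Tp + Tm = T₀ := EightTorsion.Tp_add_Tm h₁ h₂ h₃ h2 hw _ _ _
  -- `ψ` on the named points
  have hψR : ψ R = Tm := EightTorsion.sqrtNegTwo_R hp2 sK hsK hw _ _
  have hxp : (-2 + w) ^ 2 + 4 * (-2 + w) + 2 = 0 := by linear_combination hw
  have hxm : (-2 - w) ^ 2 + 4 * (-2 - w) + 2 = 0 := by linear_combination hw
  have hxp0 : (-2 + w : AlgebraicClosure (ZMod p)) ≠ 0 := by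
    intro h
    have e : w = 2 := by linear_combination h
    rw [e] at hw; apply h2; linear_combination hw
  have hxm0 : (-2 - w : AlgebraicClosure (ZMod p)) ≠ 0 := by
    intro h
    have e : w = -2 := by linear_combination -h
    rw [e] at hw; apply h2; linear_combination hw
  have hψTp : ψ Tp = T₀ := EightTorsion.sqrtNegTwo_T hp2 sK hsK hxp0 hxp _ _
  have hψTm : ψ Tm = T₀ := EightTorsion.sqrtNegTwo_T hp2 sK hsK hxm0 hxm _ _
  -- `σ` on the named points
  have h0p : (0 : AlgebraicClosure (ZMod p)) ^ p = 0 := zero_pow hp.ne_zero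
  have h2p : (2 : AlgebraicClosure (ZMod p)) ^ p = 2 := by rw [← frobenius_def]; exact map_ofNat _ 2
  have hm2p : (-2 : AlgebraicClosure (ZMod p)) ^ p = -2 := by rw [hpodd.neg_pow, h2p]
  have hwp : w ^ p = -w := EightTorsion.w_pow_p hp8 hw
  have hσT₀ : σ • T₀ = T₀ := by rw [hsmul]; exact EightTorsion.map_some_of_pow hfx _ _ h0p h0p
  have hσTp : σ • Tp = Tm := by
    rw [hsmul]; refine EightTorsion.map_some_of_pow hfx _ _ ?_ h0p
    rw [add_pow_char (-2) w p, hm2p, hwp]; ring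
  have hσTm : σ • Tm = Tp := by
    rw [hsmul]; refine EightTorsion.map_some_of_pow hfx _ _ ?_ h0p
    rw [sub_pow_char (-2) w, hm2p, hwp]; ring
  -- `σ R = ε R + T₋`
  have hu := EightTorsion.two_add_w_pow hp8 hw hδ
  have htp : t ^ p = (2 + w) ^ (p / 2) * t := EightTorsion.t_pow_p hp2 ht
  set ε : ℤ := if p % 16 = 11 then 1 else -1 with hεdef
  have hε : ε = 1 ∨ ε = -1 := by rw [hεdef]; split_ifs <;> simp
  have ht' : (-t) ^ 2 = 2 + w := by rw [neg_sq]; exact ht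
  have hσR : σ • R = ε • R + Tm := by
    by_cases h16 : p % 16 = 11
    · have hε1 : ε = 1 := by rw [hεdef, if_pos h16]
      rw [hε1, one_zsmul, hsmul]
      have e : Affine.Point.map f (Affine.Point.some w (2 * t) (hns _ _ eR)) =
          Affine.Point.some (-w) (2 * t * (1 - w)) (hns _ _ eRm) :=
        EightTorsion.map_some_of_pow hfx _ _ hwp (by rw [mul_pow, h2p, htp, hu, if_pos h16]; ring)
      rw [e]
      exact (EightTorsion.R_add_Tm h₁ h₂ h₃ h2 hw ht _ _ _).symm
    · have hε1 : ε = -1 := by rw [hεdef, if_neg h16]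
      rw [hε1, neg_one_zsmul, hsmul]
      have e : Affine.Point.map f (Affine.Point.some w (2 * t) (hns _ _ eR)) =
          Affine.Point.some (-w) (2 * -t * (1 - w)) (hns _ _ eRm') :=
        EightTorsion.map_some_of_pow hfx _ _ hwp (by rw [mul_pow, h2p, htp, hu, if_neg h16]; ring)
      rw [e]
      have hnegR : -R = Affine.Point.some w (2 * -t) (hns _ _ eR') := by
        rw [neg_eq_iff_add_eq_zero]
        exact Affine.Point.add_of_Y_eq rfl (by rw [EightTorsion.negY_eq h₁ h₃]; ring)
      rw [hnegR]
      exact (EightTorsion.R_add_Tm h₁ h₂ h₃ h2 hw ht' _ _ _).symm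
  -- the `2`-torsion
  have htors : ∀ X : (DeuringSqrtTwo.curve p).geomPoints, (2 : ℤ) • X = 0 →
      X = 0 ∨ X = T₀ ∨ X = Tp ∨ X = Tm := by
    intro X hX
    rw [two_zsmul] at hX
    exact EightTorsion.two_torsion_cases h₁ h₂ h₃ h₄ h₆ h2 hw hX _ _ _
  -- the pointwise Frobenius relation (Manin) at `S = -S₂`
  have hManin := WeierstrassCurve.frobenius_sq_sub_trace_smul_add_card_smul (DeuringSqrtTwo.curve p) hσ (-S₂)
  rw [ZMod.card] at hManin
  have hq : ((p : ℕ) : ℤ) % 8 = 3 := by omega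
  -- the abstract `8`-torsion lemma
  have key := EightTorsion.trace_mod_eight (DistribSMul.toAddMonoidHom _ σ) ψ.toAddMonoidHom
    (fun P ↦ ψ.equivariant σ P) (fun P ↦ DeuringSqrtTwo.sqrtNegTwo_comp_self hp2 sK hsK P)
    h2S h2R h2T₀ hT₀0 hTm0 h2Tm hψR hψTp hψTm hσT₀ hσTp hσTm hTpm hε hσR htors hq hManin
  rw [key, hεdef]
  split_ifs <;> decide

/-- The integral model `[0, 4, 0, 2, 0]` reduces to `DeuringSqrtTwo.curve p`. [cite: SilvermanAdvancedTopics1994, II Prop. 2.3.1] -/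
theorem map_B_one_eq_curve :
    (⟨0, 4, 0, 2, 0⟩ : WeierstrassCurve ℤ).map (Int.castRingHom (ZMod p)) = DeuringSqrtTwo.curve p := by
  simp only [WeierstrassCurve.map, DeuringSqrtTwo.curve, map_zero, map_ofNat]

/-- **`a_p(B₁) mod 8`, `p ≡ 3 (mod 8)`**, for the tree's `frobeniusTrace` of the integral model `[0, 4, 0, 2, 0]`.
[cite: Rajwade1968, Thm. 1] -/
theorem frobeniusTrace_B_one_mod_eight (hp8 : p % 8 = 3) :
    Literature.NumberTheory.Automorphic.frobeniusTrace (⟨0, 4, 0, 2, 0⟩ : WeierstrassCurve ℤ) p % 8 =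
      if p % 16 = 11 then 2 else 6 := by
  have h := tr_curve_mod_eight hp8
  unfold HasseManin.tr at h
  rw [ZMod.card] at h
  unfold Literature.NumberTheory.Automorphic.frobeniusTrace Literature.NumberTheory.Automorphic.numPointsMod
  rw [map_B_one_eq_curve]
  exact h

/-- **`a_p(B₁) mod 8` for `p ≡ 3 (mod 8)`** in the normalisation of `SqrtTwoTwistBrewerOneModEight`: with
`a_p(B₁) = 2a`, `a ≡ 3 (mod 4)` if `p ≡ 3 (mod 16)` and `a ≡ 1 (mod 4)` if `p ≡ 11 (mod 16)`, i.e.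
`a % 4 = (if ⌊p/8⌋ is even then 3 else 1)`. [cite: Rajwade1968, Thm. 1] [cite: LeonardWilliams1975, Theorem (p. 301)] -/
theorem frobeniusTrace_half_mod_four_of_three (hp8 : p % 8 = 3) {a : ℤ}
    (htr : Literature.NumberTheory.Automorphic.frobeniusTrace (⟨0, 4, 0, 2, 0⟩ : WeierstrassCurve ℤ) p = 2 * a) :
    a % 4 = (if (p / 8) % 2 = 0 then 3 else 1) := by
  have h := frobeniusTrace_B_one_mod_eight hp8
  rw [htr] at h
  by_cases h16 : p % 16 = 11
  · rw [if_pos h16] at h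
    rw [if_neg (by omega)]
    omega
  · rw [if_neg h16] at h
    rw [if_pos (by omega)]
    omega

end TraceModEight

/-! ### §2 Brewer's theorem and the unconditional `ℤ[√-2]` theta dictionary -/

section Brewer

variable {p : ℕ} [Fact p.Prime]

/-- ★ **Brewer's theorem for `p ≡ 3 (mod 8)`** (Brewer 1961; Leonard–Williams 1975, Theorem p. 301, case `p = 8k + 3`):
`p = c² + 2d²`, `c ≡ (−1)^{k+1} (mod 4)` ⇒ `Σ_x ((x + 2)(x² − 2)/p) = 2c`.  PROVED: unsigned Deuring
(`exists_sq_add_two_sq_and_frobeniusTrace_eq`), the `8`-torsion sign (`frobeniusTrace_half_mod_four_of_three`),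
uniqueness of `p = a² + 2b²`, and `B = χ(−1) Σχ(x³ + 4x² + 2x) = a_p(B₁)` (`χ(−1) = −1`).
[cite: Brewer1961, Theorem 2] [cite: LeonardWilliams1975, Theorem (p. 301)] -/
theorem brewer_characterSum_of_mod_eight_eq_three (hp8 : p % 8 = 3) {c d : ℤ} (hcd : (p : ℤ) = c ^ 2 + 2 * d ^ 2)
    (hc4 : c % 4 = (if (p / 8) % 2 = 0 then 3 else 1)) : brewerSum (ZMod p) = 2 * c := by
  have hp : p.Prime := Fact.out
  have hp2 : p ≠ 2 := by rintro rfl; norm_num at hp8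
  have hchar : ringChar (ZMod p) ≠ 2 := by rw [ZMod.ringChar_zmod_n]; exact hp2
  obtain ⟨a, b, hab, htr⟩ := exists_sq_add_two_sq_and_frobeniusTrace_eq hp (Or.inr hp8)
  have ha4 := frobeniusTrace_half_mod_four_of_three hp8 htr
  -- `c = a`
  have hca : c = a := by
    rcases eq_or_eq_neg_of_sq_add_two_sq hp hab hcd with h | h
    · exact h
    · exfalso; split_ifs at hc4 ha4 <;> omega
  -- `B = χ(−1) · Σ χ(x³+4x²+2x) = a_p` with `χ(−1) = -1`
  have h2 : (2 : ZMod p) ≠ 0 := Ring.two_ne_zero hchar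
  haveI hE : (⟨0, 4, 0, 2, 0⟩ : WeierstrassCurve (ZMod p)).IsElliptic := by
    have := isElliptic_B (n := (1 : ZMod p)) one_ne_zero h2; simpa using this
  unfold Literature.NumberTheory.Automorphic.frobeniusTrace Literature.NumberTheory.Automorphic.numPointsMod at htr
  rw [map_B_one_eq_curve, show DeuringSqrtTwo.curve p = (⟨0, 4, 0, 2, 0⟩ : WeierstrassCurve (ZMod p)) from rfl,
    natCard_point_eq_card_add_one_add_sum hchar _ _ hE.isUnit.ne_zero, ZMod.card] at htr
  have hsum : ∑ x : ZMod p, quadraticChar (ZMod p) (x ^ 3 + 4 * x ^ 2 + 2 * x) = -(2 * a) := by linarith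
  have hchi : quadraticChar (ZMod p) (-1) = -1 := by
    rw [quadraticChar_neg_one hchar, ZMod.card p]; exact ZMod.χ₄_nat_three_mod_four (by omega)
  have h := sum_quadraticChar_B_eq_brewerSum (F := ZMod p)
  rw [hsum, hchi] at h
  rw [hca]; linear_combination h

/-- ★★ **Brewer's character sum, `p ≡ 3 (mod 8)` clause, DISCHARGED**: the named fact
`Brewer1961_characterSum_three` of `SqrtTwoTwistBrewerThreeModEight` holds. [cite: Brewer1961, Theorem 2] -/
theorem brewer1961_characterSum_three_holds : Brewer1961_characterSum_three := by
  intro p _ hp8 c d hcd hc4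
  exact brewer_characterSum_of_mod_eight_eq_three hp8 hcd hc4

/-- `Brewer1961_characterSum_three` — `_holds` alias of `brewer1961_characterSum_three_holds` above under the fact's exact name (appended
2026-08-28, D-0026 bookkeeping: the proof term is the existing theorem of this file; no statement,
definition or attribute is edited; no new named fact; the ledger's debt table listed the fact
unproved). [cite: Brewer1961, Theorem 2] -/
theorem _root_.Literature.NumberTheory.EllipticCurves.SqrtTwoTwist.Brewer1961_characterSum_three_holds :
    Brewer1961_characterSum_three :=
  _root_.Literature.NumberTheory.EllipticCurves.SqrtTwoTwist.brewer1961_characterSum_three_holds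

/-- ★★ **Brewer's character-sum theorem (both clauses), DISCHARGED**: the named fact `Brewer1961_characterSum` of
`SqrtTwoTwistBrewer` holds — `p ≡ 1 (mod 8)` by the `2`-Sylow argument of `SqrtTwoTwistBrewerOneModEight`,
`p ≡ 3 (mod 8)` by the `8`-torsion argument here. [cite: Brewer1961, Theorem 2] [cite: LeonardWilliams1975, Theorem (p. 301)] -/
theorem brewer1961_characterSum_holds : Brewer1961_characterSum :=
  brewer1961_characterSum_of_three brewer1961_characterSum_three_holds

/-- `Brewer1961_characterSum` — `_holds` alias of `brewer1961_characterSum_holds` above under the fact's exact name (appended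
2026-08-28, D-0026 bookkeeping: the proof term is the existing theorem of this file; no statement,
definition or attribute is edited; no new named fact; the ledger's debt table listed the fact
unproved). [cite: LeonardWilliams1975, Theorem (p. 301)] -/
theorem _root_.Literature.NumberTheory.EllipticCurves.SqrtTwoTwist.Brewer1961_characterSum_holds :
    Brewer1961_characterSum :=
  _root_.Literature.NumberTheory.EllipticCurves.SqrtTwoTwist.brewer1961_characterSum_holds

/-- ★★ **`L(B_n, s)` is entire for every square-free `n` — UNCONDITIONAL** (`B_n = [0, 4n, 0, 2n², 0]`, the quadratic
twists of `256d1`): the `ℤ[√-2]` theta dictionary `hasEntireLFunction_of_brewer_of_squarefree` with Brewer's theorem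
proved. [cite: Hecke1920, §§1–2] [cite: SilvermanAdvancedTopics1994, II.10 Thm. 10.5] -/
theorem hasEntireLFunction_B {n : ℤ} (hn : Squarefree n) :
    (⟨0, 4 * (n : ℚ), 0, 2 * (n : ℚ) ^ 2, 0⟩ : WeierstrassCurve ℚ).HasEntireLFunction :=
  hasEntireLFunction_of_brewer_of_squarefree brewer1961_characterSum_holds hn

/-- ★★★ **`L(E, s)` has an entire continuation for every elliptic curve `E/ℚ` with `j(E) = 8000` — UNCONDITIONAL.**
The `j = 8000` row (CM by `ℤ[√-2]`, `d_K = -8`) of the Deuring–Hecke leaf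
`hasEntireLFunction_of_j_mem_maximalCMJInvariants` is a theorem of the tree: `hasEntireLFunction_of_j_eq_8000` (every such
`E` is `ℚ`-isomorphic to some `B_n`, `n` square-free) with Brewer's theorem proved.
[cite: SilvermanAdvancedTopics1994, II.10 Thm. 10.5 with Cor. 10.4.1] -/
theorem hasEntireLFunction_of_j_eq_8000_holds (W : WeierstrassCurve ℚ) [W.IsElliptic] (hj : W.j = 8000) :
    W.HasEntireLFunction :=
  hasEntireLFunction_of_j_eq_8000 brewer1961_characterSum_holds W hj

end Brewer

end SqrtTwoTwist

end Literature.NumberTheory.EllipticCurves
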